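import Summits.QuantumAdvantage.QuantumAdvantage.Theorems.RelativeSmolenskyA

/-! # RelativeSmolensky — part 2/2 (mechanical split for landing of `RelativeSmolensky`; content verbatim; scopes re-opened with their variables) -/

set_option linter.dupNamespace false -- D-0017: single-problem summit ⇒ `QuantumAdvantage.QuantumAdvantage` by design
noncomputable section

namespace Summit.QuantumAdvantage.QuantumAdvantage.Theorems.PairFreezing
open Classical Finset Summit.QuantumAdvantage.AdviceFreeQNC0
open Literature.Computability.MetaComplexity Literature.Computability.MetaComplexity.Smolensky
open Literature.Computability.Complexity (parityFn)
open Summit.QuantumAdvantage.QuantumAdvantage.Theses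

section Hilbert
variable {p : ℕ} [Fact p.Prime] {m : ℕ}

/-! ### (SYMMETRY) `h_S(k) + h_S(k') ≤ |S|` for `k + k' + d + 1 ≤ m` -/

/-- the dot-product pairing `v ↦ (w ↦ Σ_x v x · w x)` into the dual. -/
def dotDual (F : Type*) [Field F] (m : ℕ) : CubeFn F m →ₗ[F] Module.Dual F (CubeFn F m) :=
  LinearMap.mk₂ F (fun v w => ∑ x, v x * w x)
    (fun v v' w => by simp only [Pi.add_apply, add_mul, Finset.sum_add_distrib])
    (fun c v w => by simp only [Pi.smul_apply, smul_eq_mul, mul_assoc, Finset.mul_sum])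
    (fun v w w' => by simp only [Pi.add_apply, mul_add, Finset.sum_add_distrib])
    (fun c v w => by simp only [Pi.smul_apply, smul_eq_mul, Finset.mul_sum]; exact Finset.sum_congr rfl fun x _ => by ring)

/-- Relative-Smolensky helper `dotDual_apply` (lens-4 g9 HilbertDial; see the enclosing section docstring). -/
theorem dotDual_apply {F : Type*} [Field F] (v w : CubeFn F m) : dotDual F m v w = ∑ x, v x * w x := rfl

/-- Relative-Smolensky helper `dotDual_injective` (lens-4 g9 HilbertDial; see the enclosing section docstring). -/
theorem dotDual_injective (F : Type*) [Field F] : Function.Injective (dotDual F m) := by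
  intro v v' h
  funext x₀
  have hx := congrArg (fun φ : Module.Dual F (CubeFn F m) => φ (fun x => if x = x₀ then 1 else 0)) h
  simp only [dotDual_apply, mul_ite, mul_one, mul_zero, Finset.sum_ite_eq', Finset.mem_univ, if_true] at hx
  exact hx

/-- **SYMMETRY.** For `f` of degree `≤ d` and `k + k' + d + 1 ≤ m`: `h_S(k) + h_S(k') ≤ |S|`. -/
theorem hilbertFn_add_hilbertFn_le {d k k' : ℕ} {f : (Fin m → Bool) → Bool} (hf : HasDegF p f d)
    (hkk : k + k' + d + 1 ≤ m) :
    hilbertFn (ZMod p) (levelT f) k + hilbertFn (ZMod p) (levelT f) k' ≤ (levelT f).card := by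
  set S := levelT f with hS
  set X : Submodule (ZMod p) (CubeFn (ZMod p) m) := (lowDeg (ZMod p) m k).map (projOn (ZMod p) S) with hX
  set Y₀ : Submodule (ZMod p) (CubeFn (ZMod p) m) := (lowDeg (ZMod p) m k').map (projOn (ZMod p) S) with hY₀
  set Y : Submodule (ZMod p) (CubeFn (ZMod p) m) := Y₀.map (LinearMap.mulLeft (ZMod p) (pmMono (ZMod p) univ))
    with hY
  set Z : Submodule (ZMod p) (CubeFn (ZMod p) m) := LinearMap.ker (projOn (ZMod p) S) with hZ
  -- dimensions of the players
  have hXd : Module.finrank (ZMod p) X = hilbertFn (ZMod p) S k := rfl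
  have hY₀d : Module.finrank (ZMod p) Y₀ = hilbertFn (ZMod p) S k' := rfl
  have hYd : Module.finrank (ZMod p) Y = hilbertFn (ZMod p) S k' := by
    rw [hY, ← coe_mulEquiv _ (pmMono_mul_self univ), LinearEquiv.finrank_map_eq, hY₀d]
  have hV : Module.finrank (ZMod p) (CubeFn (ZMod p) m) = 2 ^ m := finrank_cubeFn
  have hRZ : Module.finrank (ZMod p) (LinearMap.range (projOn (ZMod p) S)) + Module.finrank (ZMod p) Z = 2 ^ m := by
    rw [hZ, LinearMap.finrank_range_add_finrank_ker, hV]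
  have hRle : Module.finrank (ZMod p) (LinearMap.range (projOn (ZMod p) S)) ≤ S.card := by
    have : LinearMap.range (projOn (ZMod p) S) = (lowDeg (ZMod p) m m).map (projOn (ZMod p) S) := by
      rw [LinearMap.range_eq_map, lowDeg_self_eq_top]
    rw [this]
    exact hilbertFn_le_card (F := ZMod p) S m
  -- `X ⊓ Z = ⊥`
  have hXZ : X ⊓ Z = ⊥ := by
    refine eq_bot_iff.2 fun v hv => ?_
    rw [Submodule.mem_inf] at hv
    obtain ⟨⟨w, -, rfl⟩, hz⟩ := hv
    rw [hZ, LinearMap.mem_ker, projOn_projOn] at hz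
    rw [Submodule.mem_bot]; exact hz
  have hXZd : Module.finrank (ZMod p) ↥(X ⊔ Z) = Module.finrank (ZMod p) X + Module.finrank (ZMod p) Z := by
    have h := Submodule.finrank_sup_add_finrank_inf_eq X Z
    rw [hXZ, finrank_bot, add_zero] at h
    exact h
  -- `Y` is orthogonal to `X ⊔ Z`
  have hperp : Y.map (dotDual (ZMod p) m) ≤ (X ⊔ Z).dualAnnihilator := by
    rintro _ ⟨y, hy, rfl⟩
    rw [Submodule.mem_dualAnnihilator]
    obtain ⟨y₀, ⟨Q, hQ, rfl⟩, rfl⟩ := hy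
    have hker : X ⊔ Z ≤ LinearMap.ker (dotDual (ZMod p) m (LinearMap.mulLeft (ZMod p) (pmMono (ZMod p) univ)
        (projOn (ZMod p) S Q))) := by
      refine sup_le ?_ ?_
      · rintro _ ⟨P, hP, rfl⟩
        rw [LinearMap.mem_ker, dotDual_apply]
        have hprod : indF p f * Q * P ∈ lowDeg (ZMod p) m (d + k' + k) :=
          mul_mem_lowDeg_add (mul_mem_lowDeg_add hf hQ) hP
        have h0 := sum_pmMono_univ_mul_eq_zero (p := p) (by omega) hprod
        refine Eq.trans (Finset.sum_congr rfl fun x _ => ?_) h0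
        rw [LinearMap.mulLeft_apply, Pi.mul_apply, hS, projOn_levelT_eq, projOn_levelT_eq]
        simp only [Pi.mul_apply]
        have hi := congrFun (indF_mul_indF (p := p) f) x
        rw [Pi.mul_apply] at hi
        calc pmMono (ZMod p) univ x * (indF p f x * Q x) * (indF p f x * P x)
            = pmMono (ZMod p) univ x * ((indF p f x * indF p f x) * Q x * P x) := by ring
          _ = pmMono (ZMod p) univ x * (indF p f x * Q x * P x) := by rw [hi]
      · intro z hz
        rw [hZ, LinearMap.mem_ker] at hz
        rw [LinearMap.mem_ker, dotDual_apply]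
        refine Finset.sum_eq_zero fun x _ => ?_
        rw [LinearMap.mulLeft_apply, Pi.mul_apply, projOn_apply']
        have hzx := congrFun hz x
        rw [projOn_apply'] at hzx
        by_cases hx : x ∈ S
        · rw [if_pos hx] at hzx; change z x = 0 at hzx; rw [hzx]; ring
        · rw [if_neg hx]; ring
    intro w hw
    exact LinearMap.mem_ker.1 (hker hw)
  -- count
  have h1 : Module.finrank (ZMod p) (Y.map (dotDual (ZMod p) m)) = Module.finrank (ZMod p) Y :=
    (Submodule.equivMapOfInjective _ (dotDual_injective (ZMod p)) Y).finrank_eq.symm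
  have h2 : Module.finrank (ZMod p) (Y.map (dotDual (ZMod p) m)) ≤
      Module.finrank (ZMod p) (X ⊔ Z).dualAnnihilator := Submodule.finrank_mono hperp
  have h3 := Subspace.finrank_add_finrank_dualAnnihilator_eq (X ⊔ Z)
  rw [hV] at h3
  omega

/-! ### (TAIL) the binomial estimate `4·Σ_{j ≤ ⌈m/2⌉−1−d} C(m,j) ≥ 2^m` for `m ≥ 16(d+1)²` -/

-- reused from the tree: `Smolensky.succ_mul_centralBinom_sq_le` ((2a+1)·C(2a,a)² ≤ 16^a, `SmolenskyParity`),
-- `ChooseMiddleLe.choose_half_sq_mul_le_all` (C(m,m/2)²·m ≤ 4^m), `sum_choose_succ_le_two_mul` (Pascal, `TwoClassAvoidance`).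

/-- half the cube lies at or below the middle layer: `2^{m-1} ≤ Σ_{j ≤ ⌊m/2⌋} C(m,j)` (`m ≥ 1`). -/
theorem two_pow_pred_le_numMonomials_half {m : ℕ} (hm : 1 ≤ m) : 2 ^ (m - 1) ≤ numMonomials m (m / 2) := by
  unfold numMonomials
  obtain ⟨a, rfl | rfl⟩ := Nat.even_or_odd' m
  · have ha : 1 ≤ a := by omega
    obtain ⟨b, rfl⟩ : ∃ b, a = b + 1 := ⟨a - 1, by omega⟩
    have h2 : 2 * (b + 1) / 2 = b + 1 := by omega
    rw [h2]
    -- `Σ_{j ≤ b+1} C(2b+3?..)`: use `Σ_{j≤b+1} C(2b+2+1, j) ≤ 2 Σ_{j ≤ b+1} C(2b+2, j)` and the halfway identity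
    have hh := Nat.sum_range_choose_halfway (b + 1)
    have hs := sum_choose_succ_le_two_mul (2 * (b + 1)) (b + 1)
    have e : 2 * (b + 1) - 1 = 2 * b + 1 := by omega
    rw [e]
    have e4 : (4 : ℕ) ^ (b + 1) = 2 * 2 ^ (2 * b + 1) := by
      rw [show (4 : ℕ) = 2 ^ 2 by norm_num, ← pow_mul]; ring
    rw [hh] at hs
    omega
  · have h2 : (2 * a + 1) / 2 = a := by omega
    rw [h2, Nat.sum_range_choose_halfway a, show 2 * a + 1 - 1 = 2 * a by omega, pow_mul]
    norm_num

/-- a sum of `t` further binomial coefficients, each bounded by `c`. -/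
theorem sum_range_choose_le_add (m s t c : ℕ) (hc : ∀ j, m.choose j ≤ c) :
    ∑ j ∈ range (s + t + 1), m.choose j ≤ ∑ j ∈ range (s + 1), m.choose j + t * c := by
  induction t with
  | zero => simp
  | succ t ih =>
    rw [show s + (t + 1) + 1 = (s + t + 1) + 1 by ring, Finset.sum_range_succ]
    have := hc (s + t + 1)
    nlinarith [ih, this]

/-- the layers between `s` and `⌊m/2⌋` hold at most `(⌊m/2⌋ − s)·C(m,⌊m/2⌋)` points. -/
theorem numMonomials_half_le (m s : ℕ) (hs : s ≤ m / 2) :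
    numMonomials m (m / 2) ≤ numMonomials m s + (m / 2 - s) * m.choose (m / 2) := by
  obtain ⟨t, ht⟩ : ∃ t, m / 2 = s + t := ⟨m / 2 - s, by omega⟩
  have h := sum_range_choose_le_add m s t (m.choose (m / 2)) fun j => Nat.choose_le_middle j m
  unfold numMonomials
  rw [ht] at h ⊢
  rw [Nat.add_sub_cancel_left]
  exact h

/-- **TAIL.** `m ≥ 16(d+1)²` ⇒ `2^m ≤ 4 · Σ_{j ≤ m−1−d−⌊m/2⌋} C(m,j)`. -/
theorem two_pow_le_four_mul_numMonomials {m d : ℕ} (hm : 16 * (d + 1) ^ 2 ≤ m) :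
    2 ^ m ≤ 4 * numMonomials m (m - 1 - d - m / 2) := by
  set s := m - 1 - d - m / 2 with hs
  have hd1 : 1 ≤ (d + 1) ^ 2 := Nat.one_le_pow _ _ (Nat.succ_pos d)
  have hm1 : 1 ≤ m := by omega
  have hsle : s ≤ m / 2 := by omega
  have hgap : m / 2 - s ≤ d + 1 := by omega
  have hhalf := two_pow_pred_le_numMonomials_half hm1
  have hlay := numMonomials_half_le m s hsle
  have hC : m * m.choose (m / 2) ^ 2 ≤ 4 ^ m := by
    rw [mul_comm]; exact Summit.QuantumAdvantage.DigitPolyUniformity.SketchLAR.ChooseMiddleLe.choose_half_sq_mul_le_all m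
  -- `4(d+1)·C(m,m/2) ≤ 2^m`
  have hsq : (4 * ((d + 1) * m.choose (m / 2))) ^ 2 ≤ (2 ^ m) ^ 2 := by
    calc (4 * ((d + 1) * m.choose (m / 2))) ^ 2 = 16 * (d + 1) ^ 2 * m.choose (m / 2) ^ 2 := by ring
      _ ≤ m * m.choose (m / 2) ^ 2 := Nat.mul_le_mul_right _ hm
      _ ≤ 4 ^ m := hC
      _ = (2 ^ m) ^ 2 := by rw [← pow_mul, show (4 : ℕ) = 2 ^ 2 by norm_num, ← pow_mul, mul_comm]
  have h4 : 4 * ((d + 1) * m.choose (m / 2)) ≤ 2 ^ m := (Nat.pow_le_pow_iff_left (by norm_num)).1 hsq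
  have h2m : 2 ^ m = 2 * 2 ^ (m - 1) := by
    obtain ⟨b, rfl⟩ : ∃ b, m = b + 1 := ⟨m - 1, by omega⟩
    rw [Nat.add_sub_cancel, pow_succ, mul_comm]
  have hmid : (m / 2 - s) * m.choose (m / 2) ≤ (d + 1) * m.choose (m / 2) := Nat.mul_le_mul_right _ hgap
  omega

/-! ### THE LAW -/

/-- **RELATIVE SMOLENSKY (the Hilbert law).** For an odd prime `p`, every Boolean function of `𝔽_p`-degree `≤ d`
on `m ≥ 16(d+1)²` bits is `3`-balanced: its odd and even parts are within a factor `3` of each other. -/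
theorem relBal_three_of_sq_le (hp2 : p ≠ 2) {d : ℕ} {f : (Fin m → Bool) → Bool} (hf : HasDegF p f d)
    (hm : 16 * (d + 1) ^ 2 ≤ m) : RelBal 3 f := by
  have hN : (levelT f).card = (oddPart f).card + (evenPart f).card := card_level_eq f
  have hO := card_oddPart_le_hilbertFn hp2 f
  have hE := card_evenPart_le_hilbertFn hp2 f
  have hd1 : 1 ≤ (d + 1) ^ 2 := Nat.one_le_pow _ _ (Nat.succ_pos d)
  have hm1 : d + 1 + m / 2 ≤ m := by
    have : 16 * (d + 1) ≤ 16 * (d + 1) ^ 2 := by nlinarith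
    omega
  have hsym := hilbertFn_add_hilbertFn_le (p := p) (k := m / 2) (k' := m - 1 - d - m / 2) hf (by omega)
  have hdens := numMonomials_mul_card_le_two_pow_mul_hilbertFn (F := ZMod p) (levelT f) (m - 1 - d - m / 2)
  have htail := two_pow_le_four_mul_numMonomials hm
  -- `N ≤ 4·h_S(s)`
  have h4 : (levelT f).card ≤ 4 * hilbertFn (ZMod p) (levelT f) (m - 1 - d - m / 2) := by
    have : 2 ^ m * (levelT f).card ≤ 2 ^ m * (4 * hilbertFn (ZMod p) (levelT f) (m - 1 - d - m / 2)) := by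
      calc 2 ^ m * (levelT f).card
          ≤ 4 * numMonomials m (m - 1 - d - m / 2) * (levelT f).card := Nat.mul_le_mul_right _ htail
        _ = 4 * (numMonomials m (m - 1 - d - m / 2) * (levelT f).card) := by ring
        _ ≤ 4 * (2 ^ m * hilbertFn (ZMod p) (levelT f) (m - 1 - d - m / 2)) := Nat.mul_le_mul_left _ hdens
        _ = 2 ^ m * (4 * hilbertFn (ZMod p) (levelT f) (m - 1 - d - m / 2)) := by ring
    exact Nat.le_of_mul_le_mul_left this (by positivity)
  unfold RelBal
  constructor <;> omega

/-- **the `B = 2` law at ratio `3`, `A = 16`** (item 29180's content for each odd prime, in dial form). -/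
theorem relSmolLaw_three_two (p : ℕ) [Fact p.Prime] (hp2 : p ≠ 2) :
    ∃ A : ℕ, ∀ m d : ℕ, A * (d + 1) ^ 2 ≤ m → ∀ f : (Fin m → Bool) → Bool, HasDegF p f d → RelBal 3 f :=
  ⟨16, fun _ _ hm _ hf => relBal_three_of_sq_le hp2 hf hm⟩

/-! ### EVERY RATIO: the relative bias tends to `0` at quadratic threshold -/

/-- **TAIL, general ratio.** `R ≥ 2`, `m ≥ 4(R+1)²(d+1)²` ⇒ `2^m ≤ (R+1) · Σ_{j ≤ m−1−d−⌊m/2⌋} C(m,j)`. -/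
theorem two_pow_le_mul_numMonomials {m d R : ℕ} (hR : 2 ≤ R) (hm : 4 * (R + 1) ^ 2 * (d + 1) ^ 2 ≤ m) :
    2 ^ m ≤ (R + 1) * numMonomials m (m - 1 - d - m / 2) := by
  set s := m - 1 - d - m / 2 with hs
  have hd1 : 1 ≤ (d + 1) ^ 2 := Nat.one_le_pow _ _ (Nat.succ_pos d)
  have hR1 : 1 ≤ (R + 1) ^ 2 := Nat.one_le_pow _ _ (Nat.succ_pos R)
  have hm1 : 1 ≤ m := by nlinarith
  have hsle : s ≤ m / 2 := by omega
  have hgap : m / 2 - s ≤ d + 1 := by omega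
  have hhalf := two_pow_pred_le_numMonomials_half hm1
  have hlay := numMonomials_half_le m s hsle
  have hC : m * m.choose (m / 2) ^ 2 ≤ 4 ^ m := by
    rw [mul_comm]; exact Summit.QuantumAdvantage.DigitPolyUniformity.SketchLAR.ChooseMiddleLe.choose_half_sq_mul_le_all m
  -- `2(R+1)(d+1)·C(m,m/2) ≤ 2^m`
  have hsq : (2 * ((R + 1) * ((d + 1) * m.choose (m / 2)))) ^ 2 ≤ (2 ^ m) ^ 2 := by
    calc (2 * ((R + 1) * ((d + 1) * m.choose (m / 2)))) ^ 2
        = 4 * (R + 1) ^ 2 * (d + 1) ^ 2 * m.choose (m / 2) ^ 2 := by ring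
      _ ≤ m * m.choose (m / 2) ^ 2 := Nat.mul_le_mul_right _ hm
      _ ≤ 4 ^ m := hC
      _ = (2 ^ m) ^ 2 := by rw [← pow_mul, show (4 : ℕ) = 2 ^ 2 by norm_num, ← pow_mul, mul_comm]
  have h4 : 2 * ((R + 1) * ((d + 1) * m.choose (m / 2))) ≤ 2 ^ m :=
    (Nat.pow_le_pow_iff_left (by norm_num)).1 hsq
  have h2m : 2 ^ m = 2 * 2 ^ (m - 1) := by
    obtain ⟨b, rfl⟩ : ∃ b, m = b + 1 := ⟨m - 1, by omega⟩
    rw [Nat.add_sub_cancel, pow_succ, mul_comm]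
  have hmid : (m / 2 - s) * m.choose (m / 2) ≤ (d + 1) * m.choose (m / 2) := Nat.mul_le_mul_right _ hgap
  -- linear bookkeeping with the products as atoms
  have e1 : (R + 1) * 2 ^ (m - 1) ≤ (R + 1) * numMonomials m s + (R + 1) * ((d + 1) * m.choose (m / 2)) := by
    rw [← mul_add]; exact Nat.mul_le_mul_left _ (by omega)
  have e2 : (R + 1) * ((d + 1) * m.choose (m / 2)) ≤ 2 ^ (m - 1) := by omega
  have e3 : 2 * 2 ^ (m - 1) ≤ R * 2 ^ (m - 1) := Nat.mul_le_mul_right _ hR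
  have e4 : (R + 1) * 2 ^ (m - 1) = R * 2 ^ (m - 1) + 2 ^ (m - 1) := by ring
  omega

/-- **RELATIVE SMOLENSKY AT EVERY RATIO.** For an odd prime `p`, `R ≥ 2`, and `f` of `𝔽_p`-degree `≤ d` on
`m ≥ 4(R+1)²(d+1)²` bits: `#odd ≤ R·#even` and `#even ≤ R·#odd` — the relative parity bias of a low-degree level set
tends to `0` at QUADRATIC threshold. -/
theorem relBal_of_sq_le (hp2 : p ≠ 2) {R d : ℕ} (hR : 2 ≤ R) {f : (Fin m → Bool) → Bool} (hf : HasDegF p f d)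
    (hm : 4 * (R + 1) ^ 2 * (d + 1) ^ 2 ≤ m) : RelBal R f := by
  have hN : (levelT f).card = (oddPart f).card + (evenPart f).card := card_level_eq f
  have hO := card_oddPart_le_hilbertFn hp2 f
  have hE := card_evenPart_le_hilbertFn hp2 f
  have hd1 : 1 ≤ (d + 1) ^ 2 := Nat.one_le_pow _ _ (Nat.succ_pos d)
  have hR1 : 9 ≤ (R + 1) ^ 2 := by nlinarith
  have hm1 : d + 1 + m / 2 ≤ m := by
    have : 36 * (d + 1) ≤ 4 * (R + 1) ^ 2 * (d + 1) ^ 2 := by nlinarith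
    omega
  have hsym := hilbertFn_add_hilbertFn_le (p := p) (k := m / 2) (k' := m - 1 - d - m / 2) hf (by omega)
  have hdens := numMonomials_mul_card_le_two_pow_mul_hilbertFn (F := ZMod p) (levelT f) (m - 1 - d - m / 2)
  have htail := two_pow_le_mul_numMonomials hR hm
  -- `N ≤ (R+1)·h_S(s)`
  have h4 : (levelT f).card ≤ (R + 1) * hilbertFn (ZMod p) (levelT f) (m - 1 - d - m / 2) := by
    have : 2 ^ m * (levelT f).card ≤ 2 ^ m * ((R + 1) * hilbertFn (ZMod p) (levelT f) (m - 1 - d - m / 2)) := by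
      calc 2 ^ m * (levelT f).card
          ≤ (R + 1) * numMonomials m (m - 1 - d - m / 2) * (levelT f).card := Nat.mul_le_mul_right _ htail
        _ = (R + 1) * (numMonomials m (m - 1 - d - m / 2) * (levelT f).card) := by ring
        _ ≤ (R + 1) * (2 ^ m * hilbertFn (ZMod p) (levelT f) (m - 1 - d - m / 2)) := Nat.mul_le_mul_left _ hdens
        _ = 2 ^ m * ((R + 1) * hilbertFn (ZMod p) (levelT f) (m - 1 - d - m / 2)) := by ring
    exact Nat.le_of_mul_le_mul_left this (by positivity)
  -- linear bookkeeping with the products as atoms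
  have eO : (R + 1) * ((oddPart f).card + hilbertFn (ZMod p) (levelT f) (m - 1 - d - m / 2)) ≤
      (R + 1) * (levelT f).card := Nat.mul_le_mul_left _ (by omega)
  have eE : (R + 1) * ((evenPart f).card + hilbertFn (ZMod p) (levelT f) (m - 1 - d - m / 2)) ≤
      (R + 1) * (levelT f).card := Nat.mul_le_mul_left _ (by omega)
  rw [mul_add] at eO eE
  have eN : (R + 1) * (levelT f).card = R * (oddPart f).card + R * (evenPart f).card + (levelT f).card := by
    rw [hN]; ring
  have eO' : (R + 1) * (oddPart f).card = R * (oddPart f).card + (oddPart f).card := by ring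
  have eE' : (R + 1) * (evenPart f).card = R * (evenPart f).card + (evenPart f).card := by ring
  unfold RelBal
  constructor <;> omega

end Hilbert

/-! ### §15 Closing the route items BY NAME -/

section Closing

/-- lens-4 g5's conjecture `RelSmolensky p` (ratio `3`, threshold `A·(d+1)²`) — PROVED for every odd prime, `A = 16`. -/
theorem relSmolensky_holds (p : ℕ) [Fact p.Prime] (hp2 : p ≠ 2) : RelSmolensky p :=
  ⟨16, fun _ _ hm _ hf => relBal_three_of_sq_le hp2 hf hm⟩

/-- the law for the odd primes of the leaf — PROVED. -/
theorem relSmolOdd_holds : RelSmolOdd := fun p _ hp => relSmolensky_holds p (by omega)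

/-- closes item stmt-QuantumAdvantage-29180 `PolyFeatureDial.RelSmolOdd` (the route's law aside) BY NAME. PROVED. -/
theorem relSmolOdd_item_holds : PolyFeatureDial.RelSmolOdd := fun p _ hp => relSmolensky_holds p (by omega)

/-- **closes item stmt-QuantumAdvantage-28532 `PolyFeatureDial.FeatureRungPolyOdd`** (P2⁺⁺ — the blocker crux of
`route-QuantumAdvantage-PolyFeatureDial`) BY NAME: for every prime `p ≥ 5`, polylog-many Boolean features of polylog
`𝔽_p`-degree with arbitrary tables win α's u-walk game on at most `θ·2ⁿ` inputs, one `θ < 1` for all `C, C'`.  PROVED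
(`= featureRungPolyOdd_of_relSmol relSmolOdd_holds`, the landed edge of `ParityPinning`). -/
theorem featureRungPolyOdd_holds : PolyFeatureDial.FeatureRungPolyOdd := featureRungPolyOdd_of_relSmol relSmolOdd_holds

/-- … hence the residual piece `PinningRungOdd` of `ParityPinning` — PROVED (it is vacuous under the law). -/
theorem pinningRungOdd_holds : PinningRungOdd := pinningRungOdd_of_relSmol relSmolOdd_holds

/-- **the route decides its leaf from its declared residual ALONE**: `PolyFeatureShadow (28533) → AdviceFreeQNC0Odd`. -/
theorem closes_residual (h : PolyFeatureDial.PolyFeatureShadow) : AdviceFreeQNC0Odd := closes_of_relSmol h relSmolOdd_holds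

/-- **the exact dial**: for an odd prime and every ratio `R ≥ 2`, the polynomial-threshold law at exponent `2`,
`A = 4(R+1)²` — the relative parity bias of a low-degree level set tends to `0`. (Exponent `1` is false at every ratio:
lineage file g6 `two_le_of_relSmolLaw`, witness = the parity of `2(q−1)` bits times a free bit, `q ∈ {p, p²}`.) -/
theorem relSmolLaw_two (p : ℕ) [Fact p.Prime] (hp2 : p ≠ 2) {R : ℕ} (hR : 2 ≤ R) :
    ∃ A : ℕ, ∀ m d : ℕ, A * (d + 1) ^ 2 ≤ m → ∀ f : (Fin m → Bool) → Bool, HasDegF p f d → RelBal R f :=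
  ⟨4 * (R + 1) ^ 2, fun _ _ hm _ hf => relBal_of_sq_le hp2 hR hf hm⟩

end Closing

end Summit.QuantumAdvantage.QuantumAdvantage.Theorems.PairFreezing
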